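import Summits.QuantumFields.YangMills.Theorems.BalabanUVNodesN15KingModelProp37AtRegularFieldBox

/-!
# N15 (NE2⁺, row s3 KING-MODEL ∕ RIEMANN-KERNEL RUNG) — PART Ζ-e₃: NON-VACUITY OF THE BOX EDITION — the hypotheses of `prop37PrintedAt_king_regularField_box` are
# met and King's print-order schema holds on an explicit interval-box member (`Prop37KingOrder (kingSliceKernelsRegBox … 0 …)`, carrier non-empty)

count-neutral helper of the pub-ymgap K3⁸ programme (`--supports stmt-QuantumFields-27366`); nothing here is a claim about Bałaban's
non-abelian `G(U)`, the continuum, ℝ⁴, OS axioms, a mass gap or the Clay problem.  One finite torus `T_ε` at fixed `ε`.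

[King1986] Prop. 3.7 p. 663, p. 665 «also holds for G_(j)(□′, Ã^{(k)})».  The rung's g21 witness `intervalBox_family_nonempty` supplies, above every cube-size
threshold, a cube size `K₀` (`L ∣ K₀`), a cubic torus, a level `1 ≤ k < K_P` with `L^kε ≤ 1`, and the one-big-block box `Π_μ[0, K₀L^k)` with sides at most half the
torus and a NON-EMPTY bond-closed layer; PART Ζ-e₂'s `prop37KingOrder_king_flatOnBox` at the zero field then inhabits King's print-order Proposition 3.7 on it.

* ★★ `prop37_regularField_box_family_nonempty` — `∃ K₀ P (hP1) k lo hi`, all hypotheses of the box theorem, the bond-closed carrier non-empty, and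
  `Prop37KingOrder (kingSliceKernelsRegBox hP1 C lo hi 0 m² a k K₀)`.

HONEST SCOPE.  A witness by name (g21 + Ζ-e₂); zero background member; count-neutral.  Unit `pub-ymgap-dag-n15-e` g22 (R141 (C) s3), PART Ζ-e₃.
-/

noncomputable section

namespace Summit.QuantumFields.YangMills.BalabanUVNodes.N15KingModelRung.RegularField

open Literature.MathematicalPhysics.QuantumFieldTheory.Balaban1983to89
open Literature.MathematicalPhysics.QuantumFieldTheory.Balaban1983to89.HiggsLattice (ChargeData)
open Literature.MathematicalPhysics.QuantumFieldTheory.Balaban1983to89.B1Eq211ZeroFieldTorus (Shape)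
open Literature.MathematicalPhysics.QuantumFieldTheory.Balaban1983to89.B1TorusCubeCover (half)
open Literature.MathematicalPhysics.QuantumFieldTheory.Balaban1983to89.B1Ineq225RegularBox (cellBox)
open Literature.MathematicalPhysics.QuantumFieldTheory.Balaban1983to89.B1Ineq225BackgroundTorus (three_half_le_sites)
open Literature.MathematicalPhysics.QuantumFieldTheory.King1986.SlicePropagator (Prop37KingOrder)
open Summit.QuantumFields.YangMills.BalabanUVNodes.N15KingModelRung.Curved (VSite bset intervalBox_family_nonempty)

variable {N : ℕ}

/-- ★★ **NON-VACUITY + EXHIBIT FOR THE BOX EDITION**: above the threshold of `prop37KingOrder_king_flatOnBox` there are a cube size, a volume of [Ba1] (1.2), a level and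
the one-big-block interval box `Π_μ[0, K₀L^k)` meeting every hypothesis (`K₀ ∣ M`, `3L^kK₀ ≤ |T_ε|_μ`, `L^kε ≤ 1`, sides ≤ half the torus), with NON-EMPTY bond-closed
carrier, on which `Prop37KingOrder (kingSliceKernelsRegBox hP1 C 0 1 0 m² a k K₀)` holds (zero field: flat on the box). [cite: King1986, Prop 3.7 p.663, p.665]
[cite: Balaban1982Higgs1, (1.2) p.604, p.611 l.1–2] -/
theorem prop37_regularField_box_family_nonempty (d L : ℕ) (hd : 1 ≤ d) (hL : Odd L ∧ 1 < L) {a msq : ℝ} (ha : 0 < a) (hmsq : 0 < msq)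
    (N : ℕ) (C : ChargeData N) :
    ∃ (K₀ : ℕ) (P : HiggsLattice.Params) (hP1 : 1 < P.L) (k : ℕ),
      P.d = d ∧ P.L = L ∧ K₀ ∣ P.M ∧ 1 ≤ k ∧ k ≤ P.K ∧ (∀ μ, 3 * half P k K₀ ≤ P.sitesPerDir 0 μ) ∧ P.mesh k ≤ 1 ∧
      (∀ μ, 2 * ((1 - 0) * half P k K₀) ≤ P.sitesPerDir 0 μ) ∧
      (bset (cellBox k K₀ (fun _ : Fin P.d => Finset.Ico 0 1))).Nonempty ∧
      Prop37KingOrder (kingSliceKernelsRegBox hP1 C (fun _ => 0) (fun _ => 1) (0 : HiggsLattice.VecField P 0) msq a k K₀) := by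
  obtain ⟨K₀min, h⟩ := prop37KingOrder_king_flatOnBox d L hd hL.2 ha hmsq N C
  obtain ⟨K₀, hK₀, -, P, S, k, hPd, hPL, hK₀M, h3M, hk1, hkK, hs, hside, hne⟩ := intervalBox_family_nonempty d L K₀min hd hL
  have h3 : ∀ μ, 3 * half P k K₀ ≤ P.sitesPerDir 0 μ := fun μ => three_half_le_sites hkK.le h3M μ
  exact ⟨K₀, P, S.hL.2, k, hPd, hPL, hK₀M, hk1, hkK.le, h3, hs, hside, hne,
    h K₀ hK₀ P S.hL.2 hPd hPL hK₀M hk1 hkK.le h3 hs (fun _ => 0) (fun _ => 1) hside 0 (fun _ _ _ _ => rfl)⟩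

end Summit.QuantumFields.YangMills.BalabanUVNodes.N15KingModelRung.RegularField

end
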